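import Summits.CriticalPhenomena.PercolationContinuityZ3.Theorems.PercNearOneGluingNoHeavyQuantRootDecFloorSplit
import Mathlib.Analysis.Complex.Exponential
import HarnessLib

/-!
# QUANT lane R8, Conjecture DIB\* / ARCHITECTURE FS — the PARTNER LEMMA: credit rates summing to the floor force an open partner
# (`Σ_G φ_x(g) ≥ x ⟹ ∏_G (1 − g) ≤ 1 − x`), and the TERM rule '∨ with credit' (`term_ge_of_giantRates`)

builds on p205010 (kernel theorem, internal audit signed; external expert review pending)

Support file (`--supports stmt-CriticalPhenomena-4575`), QUANT lane lead (gen 17); memo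
`run/shared/lean/prim/quant/prim-quant-lead-g17/LEAD-NOTES-G17.md` N33 addendum (d).  Theorems only, no definitions, no sorries, standard axioms.

In the floor-split architecture (`…QuantRootDecFloorSplit`, `…QuantDIBStarFloorSplitInduction`) the OPEN branch of the split on the largest blob is
certified, in > 96 % of all enumerated hard instances (lead g17 kit j128353, 219 775 exact instances), by the DISJUNCTION OF GIANTS
`1 − ∏_{giants}(1 − g) ≤ TERM` (`RootDec.term_ge_disj_giants`).  To turn that into a PROOF one needs to convert CREDIT into the product; this file does it
with the sharp constant:

* `Quant.IndepBlob.one_sub_le_floor_mul` — pointwise: for `0 < x < 1` and `g ∈ [0,1]`, `1 − g ≤ (1 − x)·(1 + x − φ_x(g))`, where the credit RATE is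
  `φ_x(g) = g` if `x ≤ g` and `κ_x(g) = (g − x²)/(1 − x)` otherwise (equality for light gates; for heavy gates it is `x ≤ g`).
* **`Quant.IndepBlob.prod_one_sub_le_of_rates` — THE PARTNER LEMMA: if `Σ_{k∈G} φ_x(g k) ≥ x` then `∏_{k∈G} (1 − g k) ≤ 1 − x`.**  Proof without AM–GM:
  `∏(1−g) ≤ (1−x)^m ∏ z_k` with `z_k = 1 + x − φ_k ≤ e^{z_k − 1}`, and `(1−x)^{m−1} ≤ e^{−(m−1)x}` (`1 − x ≤ e^{−x}`), so the product is
  `≤ (1−x)·e^{x − Σφ} ≤ 1 − x`.  (So credit rate `x` — not `1` — spread over ANY number of blobs already forces 'some blob open' with probability `≥ x`;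
  one heavy blob is the equality case.)
* **`Quant.RootDec.term_ge_of_giantRates` — TERM rule '∨ with credit': gates in `[0,1]`, `0 < x < 1`, a finset `G` of giants (`j + 1 ≤ s + a k`) whose credit
  RATES sum to `≥ x` ⟹ `x ≤ TERM[s, a, g, j]`.**  At layer `j − s = 0` every non-empty blob is a giant, so this is the right row at the bottom layer, where the
  linear-credit row `γ` (`2(j−s) < credit`) is blind (LEAD-NOTES-G17 N33 (4): the single-blob split without ∨ fails exactly there).
* `Quant.RootDec.term_ge_of_sureHub` — first closed sub-case of CONJECTURE FS-E: a SURE blob `k` (`g k = 1`) such that every blob of a finset `G ∌ k` completes it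
  (`j + 1 ≤ s + a k + a k'`) and `Σ_{G} φ_x ≥ x` ⟹ `x ≤ TERM[s, a, g, j]` (rule φ with `z₀` irrelevant + `term_ge_of_giantRates` on the open branch).  E.g. the largest
  blob sure of size `j − s`: then every other non-empty blob is a partner and the DIB\* budget gives `Σ_{others} a·φ > j − s`, hence `Σ φ > 1 ≥ x`.

NOVELTY.  presearch: 'product of failure probabilities bounded by 1 − x when success-probability credits sum to x; union-bound converse with sharp constant'
→ none specific (corpus hybrid/vsearch: Weierstrass product inequality pages, e.g. ∏(1 − a_i) ≥ 1 − Σ a_i — the OPPOSITE direction; galaxy 'Weierstrass product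
inequality|product of (1-p_i)': textbook); the discount κ_x is this lane's (ARCH-TREES-G49 §3).  [this work]; the gluing rows served [cite: KozmaNitzan2024, Conjecture 3
(p. 15)]; product weights [cite: Grimmett1999, §1.3 p. 10].
-/

namespace Summit.CriticalPhenomena.PercolationContinuityZ3.Theorems

namespace Quant

open Finset

namespace IndepBlob

/-- **Pointwise bound**: for `0 < x < 1` and any real `g`, `1 − g ≤ (1 − x)·(1 + x − φ_x(g))` with `φ_x(g) = g` (`x ≤ g`) or `(g − x²)/(1 − x)` (`g < x`);
equality in the light case. [this work] -/
theorem one_sub_le_floor_mul (x g : ℝ) (hx0 : 0 < x) (hx1 : x < 1) :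
    1 - g ≤ (1 - x) * (1 + x - (if x ≤ g then g else (g - x ^ 2) / (1 - x))) := by
  have h1x : 0 < 1 - x := by linarith
  by_cases hxg : x ≤ g
  · rw [if_pos hxg]; nlinarith
  · rw [if_neg hxg]
    have e : (1 - x) * (1 + x - (g - x ^ 2) / (1 - x)) = (1 - x) * (1 + x) - (g - x ^ 2) := by
      field_simp
    rw [e]; nlinarith

/-- **THE PARTNER LEMMA.**  `0 < x < 1`, gates `g k ∈ [0,1]`, a finset `G` with `x ≤ Σ_{k∈G} φ_x(g k)` (credit RATES, not sizes): then
`∏_{k∈G} (1 − g k) ≤ 1 − x` — some blob of `G` is open with probability at least the floor. [this work] -/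
theorem prod_one_sub_le_of_rates {κ : Type*} (x : ℝ) (hx0 : 0 < x) (hx1 : x < 1) (g : κ → ℝ) (hg : ∀ k, 0 ≤ g k ∧ g k ≤ 1)
    (G : Finset κ) (hrate : x ≤ ∑ k ∈ G, (if x ≤ g k then g k else (g k - x ^ 2) / (1 - x))) :
    ∏ k ∈ G, (1 - g k) ≤ 1 - x := by
  set φ : κ → ℝ := fun k => if x ≤ g k then g k else (g k - x ^ 2) / (1 - x) with hφ
  have h1x : 0 < 1 - x := by linarith
  -- `G` is non-empty
  have hm : 1 ≤ G.card := by
    rw [Nat.one_le_iff_ne_zero]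
    intro h0
    rw [Finset.card_eq_zero] at h0
    rw [h0, Finset.sum_empty] at hrate
    linarith
  -- step 1: pointwise, `1 − g ≤ (1−x)·exp(x − φ)`
  have hpt : ∀ k ∈ G, 1 - g k ≤ (1 - x) * Real.exp (x - φ k) := by
    intro k _
    have h1 := one_sub_le_floor_mul x (g k) hx0 hx1
    have h2 : 1 + x - φ k ≤ Real.exp (x - φ k) := by
      have := Real.add_one_le_exp (x - φ k); linarith
    exact h1.trans (mul_le_mul_of_nonneg_left h2 h1x.le)
  -- step 2: multiply
  have hprod : ∏ k ∈ G, (1 - g k) ≤ ∏ k ∈ G, ((1 - x) * Real.exp (x - φ k)) :=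
    Finset.prod_le_prod (fun k _ => by linarith [(hg k).2]) hpt
  rw [Finset.prod_mul_distrib, Finset.prod_const, ← Real.exp_sum] at hprod
  -- step 3: `(1−x)^m ≤ (1−x)·exp(−(m−1)x)` and `Σ (x − φ) ≤ m x − x`
  have hsum : ∑ k ∈ G, (x - φ k) = G.card * x - ∑ k ∈ G, φ k := by
    rw [Finset.sum_sub_distrib, Finset.sum_const, nsmul_eq_mul]
  have hpow : (1 - x) ^ G.card ≤ (1 - x) * Real.exp (-(((G.card : ℝ) - 1) * x)) := by
    have e1 : (1 - x) ^ G.card = (1 - x) * (1 - x) ^ (G.card - 1) := by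
      rw [← pow_succ', Nat.sub_add_cancel hm]
    rw [e1]
    refine mul_le_mul_of_nonneg_left ?_ h1x.le
    have h3 : (1 - x) ^ (G.card - 1) ≤ Real.exp (-x) ^ (G.card - 1) :=
      pow_le_pow_left₀ h1x.le (Real.one_sub_le_exp_neg x) _
    refine h3.trans (le_of_eq ?_)
    rw [← Real.exp_nat_mul, Nat.cast_sub hm, Nat.cast_one]
    ring_nf
  calc ∏ k ∈ G, (1 - g k) ≤ (1 - x) ^ G.card * Real.exp (∑ k ∈ G, (x - φ k)) := hprod
    _ ≤ (1 - x) * Real.exp (-(((G.card : ℝ) - 1) * x)) * Real.exp (∑ k ∈ G, (x - φ k)) :=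
        mul_le_mul_of_nonneg_right hpow (Real.exp_pos _).le
    _ = (1 - x) * Real.exp (x - ∑ k ∈ G, φ k) := by
        rw [mul_assoc, ← Real.exp_add, hsum]; ring_nf
    _ ≤ (1 - x) * 1 := by
        refine mul_le_mul_of_nonneg_left ?_ h1x.le
        rw [Real.exp_le_one_iff]
        linarith
    _ = 1 - x := mul_one _

end IndepBlob

namespace RootDec

variable {κ : Type} [Fintype κ] [DecidableEq κ]

/-- product-Bernoulli weight of the set `W` of open blobs (as in `…QuantRootReduction`) -/
local notation3 "wt[" g ", " W "]" => ∏ k, (if k ∈ (W : Finset κ) then (g : κ → ℝ) k else 1 - (g : κ → ℝ) k)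

/-- the TERM tail `P(s + Σ_{k open} a k ≥ j+1)` (as in `…QuantRootReduction`) -/
local notation3 "TERM[" s ", " a ", " g ", " j "]" =>
  ∑ W : Finset κ, wt[g, W] * (if (j : ℕ) + 1 ≤ (s : ℕ) + ∑ k ∈ W, (a : κ → ℕ) k then (1 : ℝ) else 0)

/-- **TERM rule '∨ with credit' (`term_ge_of_giantRates`).**  Gates in `[0,1]`, `0 < x < 1`, a finset `G` of giants (`j + 1 ≤ s + a k` for `k ∈ G`) whose
credit rates sum to at least the floor, `x ≤ Σ_{k∈G} φ_x(g k)`: then `x ≤ TERM[s, a, g, j]` (`term_ge_disj_giants` + the partner lemma). [this work] -/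
theorem term_ge_of_giantRates (s : ℕ) (a : κ → ℕ) (g : κ → ℝ) (j : ℕ) (x : ℝ) (hx0 : 0 < x) (hx1 : x < 1)
    (hg : ∀ k, 0 ≤ g k ∧ g k ≤ 1) (G : Finset κ) (hG : ∀ k ∈ G, j + 1 ≤ s + a k)
    (hrate : x ≤ ∑ k ∈ G, (if x ≤ g k then g k else (g k - x ^ 2) / (1 - x))) : x ≤ TERM[s, a, g, j] := by
  have h1 := IndepBlob.prod_one_sub_le_of_rates x hx0 hx1 g hg G hrate
  have h2 := term_ge_disj_giants s a g j hg G hG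
  linarith

/-- **First closed sub-case of CONJECTURE FS-E — a SURE HUB.**  Gates in `[0,1]`, `0 < x < 1`; a blob `k` with `g k = 1`; a finset `G` not containing `k`
each of whose blobs COMPLETES `k` (`j + 1 ≤ s + a k + a k'`) and whose credit rates sum to `≥ x`.  Then `x ≤ TERM[s, a, g, j]`: split on `k` (rule φ, the
closed branch has weight `1 − g k = 0`) and apply `term_ge_of_giantRates` to the open branch, where every `k' ∈ G` is a giant. [this work] -/
theorem term_ge_of_sureHub (s : ℕ) (a : κ → ℕ) (g : κ → ℝ) (j : ℕ) (x : ℝ) (hx0 : 0 < x) (hx1 : x < 1)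
    (hg : ∀ k, 0 ≤ g k ∧ g k ≤ 1) (k : κ) (hk : g k = 1) (G : Finset κ) (hkG : k ∉ G)
    (hG : ∀ k' ∈ G, j + 1 ≤ s + a k + a k')
    (hrate : x ≤ ∑ k' ∈ G, (if x ≤ g k' then g k' else (g k' - x ^ 2) / (1 - x))) : x ≤ TERM[s, a, g, j] := by
  -- the open branch: every `k' ∈ G` is a giant of the system `a[k ↦ 0]` with sure part `s + a k`
  have hG' : ∀ k' ∈ G, j + 1 ≤ (s + a k) + Function.update a k 0 k' := by
    intro k' hk'
    rw [Function.update_of_ne (ne_of_mem_of_not_mem hk' hkG)]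
    have := hG k' hk'; omega
  have hopen := term_ge_of_giantRates (s + a k) (Function.update a k 0) g j x hx0 hx1 hg G hG' hrate
  refine term_ge_of_floorSplit s a g j k x x 0 (hg k) hopen (term_nonneg s _ g j hg) ?_
  rw [hk]; ring_nf; exact le_refl _

end RootDec

end Quant

end Summit.CriticalPhenomena.PercolationContinuityZ3.Theorems
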